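import Summits.BirchSwinnertonDyer.BirchSwinnertonDyer.Theorems.ByReductionTypeAtTwoRankOneSigmaHeightValuationLaw
import HarnessLib

/-!
# Route `ByReductionTypeAtTwo`, crux `RankOneAtTwoBigImageOddLocal` (item stmt-BirchSwinnertonDyer-23715), line AN62, σ₀-LEMMA BLOCK
# (cell `bsd-f1-sign2`, planner seat `-an` g50; `--supports 23715`, helper):
# **THE 2-ADIC σ-REGULATOR VALUATION OF A POINT IS COMPUTABLE FROM ONE LEVEL-ONE MULTIPLE**

HONEST FRAMING (D-0036/D-0054): THEOREMS ONLY (no definition, no named fact, no `sorry`, no instance).  `V/ℚ` `ℤ`-integral with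
`a₁ = 0`, `D` any σ-form height datum at `2` (the pairing of a locus point `(x, y)` is `log₂ den x − log₂ σ(−x/y)` with `σ² = Sq`,
`Sq = t² + O(t⁴)` solving the σ-ODE).  For ANY point `P` and ANY `m ≥ 1` with `mP = Q = (x, y)` at level one (`‖x‖₂ = 4`) with
non-singular reduction everywhere, writing `n = num x − 1 − 8a₄ ∈ ℤ`:
* if `32 ∤ n`: **`‖⟨P,P⟩_D‖₂ = ‖n‖₂ / ‖m‖₂²`** (`norm_pairing_self_eq_of_nsmul_eq_of_not_dvd`) — i.e. `v₂⟨P,P⟩_D = v₂(n) − 2v₂(m)`,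
  an exact, elementary formula for the `2`-adic valuation of the σ-regulator of `P`;
* if `a₂` is odd: **`‖⟨P,P⟩_D‖₂ = ¼ / ‖m‖₂²`** (`norm_pairing_self_eq_quarter_div_of_nsmul_eq`);
* in every case `‖⟨P,P⟩_D‖₂ ≤ ¼ / ‖m‖₂²` (`norm_pairing_self_le_of_nsmul_eq`).
(`⟨mP,mP⟩ = m²⟨P,P⟩` is the tree's bilinearity, `…Nonvanishing.pairing_nsmul_nsmul`; the level-one values are `…ValuationLaw` /
`…LevelOneLawUnconditional`.)  Nothing here is a statement about `BSDp`; item 23715 stays OPEN; BSD is proved for no curve.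
References: [cite: MazurSteinTate2006, §1] [cite: SilvermanAEC2009, VII.2.2] [cite: Gouvea1993PadicNumbers, §5.7].
-/

set_option autoImplicit false

noncomputable section

open scoped Classical

open WeierstrassCurve PowerSeries Literature Literature.NumberTheory.EllipticCurves

namespace Summit.BirchSwinnertonDyer.BirchSwinnertonDyer.Theorems

namespace NaiveSigmaLogAtTwo

/-- `‖⟨P,P⟩_D‖ = ‖⟨mP,mP⟩_D‖ / ‖m‖²` for `m ≠ 0`. [cite: MazurSteinTate2006, §1] -/
theorem norm_pairing_self_eq_div {V : WeierstrassCurve ℚ} {p : ℕ} [Fact p.Prime] (D : PAdicHeightData V p) {m : ℕ} (hm0 : m ≠ 0)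
    (P : V.toAffine.Point) : ‖D.pairing P P‖ = ‖D.pairing (m • P) (m • P)‖ / ‖(m : ℚ_[p])‖ ^ 2 := by
  have hm : ‖(m : ℚ_[p])‖ ≠ 0 := norm_ne_zero_iff.mpr (Nat.cast_ne_zero.mpr hm0)
  rw [pairing_nsmul_nsmul, norm_mul, norm_pow]
  field_simp

/-- **`‖⟨P,P⟩_D‖₂ = ‖num x − 1 − 8a₄‖₂ / ‖m‖₂²`** when `mP = (x, y)` is a level-one point with non-singular reduction everywhere and
`32 ∤ num x − 1 − 8a₄` (`ℤ`-integral model, `a₁ = 0`, any σ-form datum `D`). [cite: MazurSteinTate2006, §1] [cite: Gouvea1993PadicNumbers, §5.7] -/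
theorem norm_pairing_self_eq_of_nsmul_eq_of_not_dvd (V : WeierstrassCurve ℚ) [V.IsIntegral ℤ] (ha1 : V.a₁ = 0)
    (Sq : ℚ_[2]⟦X⟧) (h0 : constantCoeff Sq = 0) (h1 : coeff 1 Sq = 0) (h2 : coeff 2 Sq = 1) (h3 : coeff 3 Sq = 0)
    (hODE : (V.baseChange ℚ_[2]).SatisfiesSigmaSqODE Sq 0) (D : PAdicHeightData V 2)
    (hD : ∀ {x y : ℚ} (h : V.toAffine.Nonsingular x y), V.SatisfiesLocalConditions 2 (.some x y h) →
      D.pairing (.some x y h) (.some x y h) = padicLog 2 ((x.den : ℚ) : ℚ_[2]) - padicLog 2 (padicEval Sq (-(x : ℚ_[2]) / y)))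
    (P : V.toAffine.Point) {m : ℕ} (hm0 : m ≠ 0) {x y : ℚ} (h : V.toAffine.Nonsingular x y) (hm : m • P = .some x y h)
    (hx : ‖(x : ℚ_[2])‖ = 4) (hns : ∀ ℓ : ℕ, ℓ.Prime → V.HasNonsingularReductionAt ℓ x y) {A₄ : ℤ} (hA4 : V.a₄ = A₄)
    (h32 : ¬ (32 : ℤ) ∣ x.num - 1 - 8 * A₄) :
    ‖D.pairing P P‖ = ‖((x.num - 1 - 8 * A₄ : ℤ) : ℚ_[2])‖ / ‖(m : ℚ_[2])‖ ^ 2 := by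
  rw [norm_pairing_self_eq_div D hm0 P, hm, norm_pairing_eq_norm_of_not_dvd V ha1 Sq h0 h1 h2 h3 hODE D hD h hx hns hA4 h32]

/-- **`‖⟨P,P⟩_D‖₂ = ¼ / ‖m‖₂²`** when `mP = (x, y)` is a level-one point with non-singular reduction everywhere and `a₂` is odd.
[cite: MazurSteinTate2006, §1] [cite: SilvermanAEC2009, VII.2.2] -/
theorem norm_pairing_self_eq_quarter_div_of_nsmul_eq (V : WeierstrassCurve ℚ) [V.IsIntegral ℤ] (ha1 : V.a₁ = 0)
    (Sq : ℚ_[2]⟦X⟧) (h0 : constantCoeff Sq = 0) (h1 : coeff 1 Sq = 0) (h2 : coeff 2 Sq = 1) (h3 : coeff 3 Sq = 0)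
    (hODE : (V.baseChange ℚ_[2]).SatisfiesSigmaSqODE Sq 0) (D : PAdicHeightData V 2)
    (hD : ∀ {x y : ℚ} (h : V.toAffine.Nonsingular x y), V.SatisfiesLocalConditions 2 (.some x y h) →
      D.pairing (.some x y h) (.some x y h) = padicLog 2 ((x.den : ℚ) : ℚ_[2]) - padicLog 2 (padicEval Sq (-(x : ℚ_[2]) / y)))
    (P : V.toAffine.Point) {m : ℕ} (hm0 : m ≠ 0) {x y : ℚ} (h : V.toAffine.Nonsingular x y) (hm : m • P = .some x y h)
    (hx : ‖(x : ℚ_[2])‖ = 4) (hns : ∀ ℓ : ℕ, ℓ.Prime → V.HasNonsingularReductionAt ℓ x y) (a2 : ℤ) (ha2 : V.a₂ = a2)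
    (hodd : Odd a2) :
    ‖D.pairing P P‖ = 4⁻¹ / ‖(m : ℚ_[2])‖ ^ 2 := by
  rw [norm_pairing_self_eq_div D hm0 P, hm,
    (norm_pairing_eq_quarter_iff_of_norm_eq_four V ha1 Sq h0 h1 h2 h3 hODE D hD h hx hns a2 ha2).mpr hodd]

/-- **`‖⟨P,P⟩_D‖₂ ≤ ¼ / ‖m‖₂²`** whenever `mP = (x, y)` is a level-one point with non-singular reduction everywhere.
[cite: MazurSteinTate2006, §1] -/
theorem norm_pairing_self_le_of_nsmul_eq (V : WeierstrassCurve ℚ) [V.IsIntegral ℤ] (ha1 : V.a₁ = 0)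
    (Sq : ℚ_[2]⟦X⟧) (h0 : constantCoeff Sq = 0) (h1 : coeff 1 Sq = 0) (h2 : coeff 2 Sq = 1) (h3 : coeff 3 Sq = 0)
    (hODE : (V.baseChange ℚ_[2]).SatisfiesSigmaSqODE Sq 0) (D : PAdicHeightData V 2)
    (hD : ∀ {x y : ℚ} (h : V.toAffine.Nonsingular x y), V.SatisfiesLocalConditions 2 (.some x y h) →
      D.pairing (.some x y h) (.some x y h) = padicLog 2 ((x.den : ℚ) : ℚ_[2]) - padicLog 2 (padicEval Sq (-(x : ℚ_[2]) / y)))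
    (P : V.toAffine.Point) {m : ℕ} (hm0 : m ≠ 0) {x y : ℚ} (h : V.toAffine.Nonsingular x y) (hm : m • P = .some x y h)
    (hx : ‖(x : ℚ_[2])‖ = 4) (hns : ∀ ℓ : ℕ, ℓ.Prime → V.HasNonsingularReductionAt ℓ x y) :
    ‖D.pairing P P‖ ≤ 4⁻¹ / ‖(m : ℚ_[2])‖ ^ 2 := by
  rw [norm_pairing_self_eq_div D hm0 P, hm]
  exact div_le_div_of_nonneg_right (norm_pairing_le_quarter_of_norm_eq_four V ha1 Sq h0 h1 h2 h3 hODE D hD h hx hns)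
    (by positivity)

end NaiveSigmaLogAtTwo

end Summit.BirchSwinnertonDyer.BirchSwinnertonDyer.Theorems
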